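import Mathlib
import Summits.ResolutionOfSingularities.ResolutionOfSingularities.Theorems.WeightedInvariantLocalWeightedDropWildMonicFlagDropAxisSplit
import Summits.ResolutionOfSingularities.ResolutionOfSingularities.Theorems.WeightedInvariantLocalWeightedDropWildMonicFlagN0Transport
import Summits.ResolutionOfSingularities.ResolutionOfSingularities.Theorems.WeightedInvariantLocalWeightedDropWildMonicNewtonPointStep

/-!
# `WeightedInvariant.LocalWeightedDrop`, line `hasse-ridge-face-selection`, S3ρ: the SECOND-ORIENTATION flag `(true, g, 0)` read on the
# letter swap — point-set symmetries and «the flag along the other axis never wins on `s`» (tools for `DropAxisN0Second`, Lemma 9.1.2)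

Crux item stmt-ResolutionOfSingularities-8899 `LocalWeightedDrop` (route `ResolutionOfSingularities/WeightedInvariant`), engine of the door
`HypersurfaceCentreConstruction` stmt-ResolutionOfSingularities-19897.  [OURS · L1 W4.3, chain w43, res-type-083 (S3ρ first seat, (C9) lead);
tools for the hand of `DropAxisN0Second` (`…WildMonicFlagDropAxisSplit`).  MAP: S. Perlega, arXiv:2011.14443 Lemma 9.1.2 («flags with
`n_G = 0` and `G₁ = G₂ ∩ D_new` can be ignored … If `G` is valid, then `inv(G) ≤ inv(F′)`», p0104); stub-7's `coeffOrd_swap_image_psi_eq`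
(`…WildMonicFlagN0Transport`) is the same minimal-value computation for the induced hypersurface.  Every object OURS; not a statement of any
manuscript.]

For a tuple `A`, boundary `E` and a hypersurface re-centring `g`, the second-orientation flag `(true, g, 0)` of `(A, E)` — curve = the letter
`0` — is the first-orientation flag `(swap g, 0)` of the SAME position read with the two letters exchanged:
* point sets: `newtonSet (swapT A) = swap″ newtonSet A` (`newtonSet_swapT`), `deltaL`/`alphaL`/`epsL`/`excExp`/`reduce`/`dRes`/`compSet`
  under the transpose (`deltaL_swap`, `alphaL_swap`, `epsL_swap`, `excExp_swap`, `reduce_swap`, `dRes_swap`, `compSet_swap`);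
* flags: `flagTuple d (swapT A) g 0 = swapT (flagTuple d A (swap g) 0)` (`flagTuple_swapT_zero`), the same `m` and `d` (`mOf_swapT_zero`,
  `dRes` part of `flagTriple`), and the same validity (`isMMax_swapT_zero_iff`);
* «NEVER WINS ON `s`»: if the reduced set of the first-orientation reading has a point `P` ON ITS INITIAL LINE with `P₀ < δ` (e.g. the
  corner `(0, δ)` after an axis step with `δ` kept — stub-7's `eq_corner_of_deltaL_image_psi_eq`), then the second reading of `s` takes the
  MINIMAL value (`δ!`, resp. `(δ(d!−δ))!` in the companion case), hence `sValue` of the swapped reading `≤ sValue` of the first reading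
  (`sValue_swap_le_of_face_point`) and `flagTriple d (swapT A) (swapE E) g 0 ≤ flagTriple d A E (swap g) 0` (`flagTriple_swapT_zero_le`).
-/

set_option linter.dupNamespace false -- mandated namespace of this single-conjunct summit

noncomputable section

namespace Summit.ResolutionOfSingularities.ResolutionOfSingularities.Theorems

open Literature.AlgebraicGeometry.Resolution
open Literature.AlgebraicGeometry.Resolution.HauserPerlega2024 (Triple)

namespace WildMonic

open MvPowerSeries MonicDescent
open PurePowerFlag (swap swapE orient orientE IsN0 IsTangent succE)

variable {k : Type} [Field k] {d : ℕ}

/-! ### Point sets under the transpose of the two letters -/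

section PointSets

variable (N : Set (Fin 2 →₀ ℕ))

/-- The transpose is an involution on points. -/
theorem swapPt_swapPt (P : Fin 2 →₀ ℕ) :
    Finsupp.equivMapDomain (Equiv.swap (0 : Fin 2) 1) (Finsupp.equivMapDomain (Equiv.swap (0 : Fin 2) 1) P) = P :=
  Literature.RingTheory.TwoVariableSeries.finsupp_fin2_ext (by rw [swapPt_apply_zero, swapPt_apply_one])
    (by rw [swapPt_apply_one, swapPt_apply_zero])

/-- The transpose is an involution on point sets. -/
theorem swap_swap_image :
    Finsupp.equivMapDomain (Equiv.swap (0 : Fin 2) 1) '' (Finsupp.equivMapDomain (Equiv.swap (0 : Fin 2) 1) '' N) = N := by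
  rw [Set.image_image]
  simp only [swapPt_swapPt, Set.image_id']

/-- Total degrees are symmetric. -/
theorem deltaL_swap : deltaL (Finsupp.equivMapDomain (Equiv.swap (0 : Fin 2) 1) '' N) = deltaL N := by
  unfold deltaL
  rw [Set.image_image]
  congr 1
  refine Set.image_congr fun P _ => ?_
  rw [swapPt_apply_zero, swapPt_apply_one, add_comm]

/-- The least first coordinate of the transpose is the least second coordinate. -/
theorem alphaL_swap : alphaL (Finsupp.equivMapDomain (Equiv.swap (0 : Fin 2) 1) '' N) = epsL N := by
  unfold alphaL epsL
  rw [Set.image_image]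
  congr 1

/-- The least second coordinate of the transpose is the least first coordinate. -/
theorem epsL_swap : epsL (Finsupp.equivMapDomain (Equiv.swap (0 : Fin 2) 1) '' N) = alphaL N := by
  unfold alphaL epsL
  rw [Set.image_image]
  congr 1

/-- The exceptional exponents for the swapped boundary of the transposed set are the transposed exceptional exponents. -/
theorem excExp_swap (E : Finset (Fin 2)) :
    excExp (swapE E) (Finsupp.equivMapDomain (Equiv.swap (0 : Fin 2) 1) '' N) =
      Finsupp.equivMapDomain (Equiv.swap (0 : Fin 2) 1) (excExp E N) := by
  refine Literature.RingTheory.TwoVariableSeries.finsupp_fin2_ext ?_ ?_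
  · rw [excExp_apply_zero, swapPt_apply_zero, excExp_apply_one, alphaL_swap]
    simp only [PurePowerFlag.mem_swapE, Equiv.swap_apply_left]
  · rw [excExp_apply_one, swapPt_apply_one, excExp_apply_zero, epsL_swap]
    simp only [PurePowerFlag.mem_swapE, Equiv.swap_apply_right]

/-- Truncated subtraction commutes with the transpose. -/
theorem swapPt_tsub (P r : Fin 2 →₀ ℕ) :
    Finsupp.equivMapDomain (Equiv.swap (0 : Fin 2) 1) P - Finsupp.equivMapDomain (Equiv.swap (0 : Fin 2) 1) r =
      Finsupp.equivMapDomain (Equiv.swap (0 : Fin 2) 1) (P - r) :=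
  Literature.RingTheory.TwoVariableSeries.finsupp_fin2_ext
    (by rw [Finsupp.tsub_apply, swapPt_apply_zero, swapPt_apply_zero, swapPt_apply_zero, Finsupp.tsub_apply])
    (by rw [Finsupp.tsub_apply, swapPt_apply_one, swapPt_apply_one, swapPt_apply_one, Finsupp.tsub_apply])

/-- The reduced set of the transpose is the transpose of the reduced set. -/
theorem reduce_swap (r : Fin 2 →₀ ℕ) :
    reduce (Finsupp.equivMapDomain (Equiv.swap (0 : Fin 2) 1) r) (Finsupp.equivMapDomain (Equiv.swap (0 : Fin 2) 1) '' N) =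
      Finsupp.equivMapDomain (Equiv.swap (0 : Fin 2) 1) '' reduce r N := by
  unfold reduce
  rw [Set.image_image, Set.image_image]
  exact Set.image_congr fun P _ => swapPt_tsub P r

/-- `d_F` is symmetric under the exchange of the two letters (with the boundary exchanged too). -/
theorem dRes_swap (E : Finset (Fin 2)) : dRes (swapE E) (Finsupp.equivMapDomain (Equiv.swap (0 : Fin 2) 1) '' N) = dRes E N := by
  unfold dRes
  rw [excExp_swap, reduce_swap, deltaL_swap]

/-- Scalar multiples commute with the transpose (point form of `smul_swapPt`). -/
theorem swapPt_smul (n : ℕ) (P : Fin 2 →₀ ℕ) :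
    Finsupp.equivMapDomain (Equiv.swap (0 : Fin 2) 1) (n • P) = n • Finsupp.equivMapDomain (Equiv.swap (0 : Fin 2) 1) P :=
  (smul_swapPt n P).symm

/-- The companion set of the transpose is the transpose of the companion set. -/
theorem compSet_swap (L : ℕ) (r : Fin 2 →₀ ℕ) (S : Set (Fin 2 →₀ ℕ)) :
    compSet L (Finsupp.equivMapDomain (Equiv.swap (0 : Fin 2) 1) r) (Finsupp.equivMapDomain (Equiv.swap (0 : Fin 2) 1) '' S) =
      Finsupp.equivMapDomain (Equiv.swap (0 : Fin 2) 1) '' compSet L r S := by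
  unfold compSet
  rw [deltaL_swap, Set.image_insert_eq, swapPt_smul, Set.image_image, Set.image_image]
  congr 1
  exact Set.image_congr fun P _ => (swapPt_smul _ P).symm

/-- «THE OTHER AXIS NEVER WINS ON `s`», plain case: a point `P` of `S` on the initial line (`P₀ + P₁ = δ`) with `P₀ < δ` gives the second
reading of the coefficient-ideal order its MINIMAL value: `coeffOrd δ (swap″ S) ≤ δ!`. -/
theorem coeffOrd_swap_le_factorial {S : Set (Fin 2 →₀ ℕ)} {δ : ℕ} {P : Fin 2 →₀ ℕ} (hP : P ∈ S) (hP0 : P 0 < δ)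
    (hPδ : P 0 + P 1 = δ) :
    coeffOrd δ (Finsupp.equivMapDomain (Equiv.swap (0 : Fin 2) 1) '' S) ≤ ((δ.factorial : ℕ) : ℕ∞) := by
  have h := coeffOrd_le (S := Finsupp.equivMapDomain (Equiv.swap (0 : Fin 2) 1) '' S) (δ := δ)
    (P := Finsupp.equivMapDomain (Equiv.swap (0 : Fin 2) 1) P) ⟨P, hP, rfl⟩ (by rw [swapPt_apply_one]; exact hP0)
  rw [swapPt_apply_one, swapPt_apply_zero] at h
  have hP1 : P 1 = δ - P 0 := by omega
  rw [hP1, Nat.div_mul_cancel (Nat.dvd_factorial (by omega) (by omega))] at h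
  exact h

/-- «THE OTHER AXIS NEVER WINS ON `s`», companion case: the dilated face point gives `coeffOrd (δ(L−δ)) (swap″ compSet) ≤ (δ(L−δ))!`
(`δ = deltaL S`, `0 < δ < L`). -/
theorem coeffOrd_swap_compSet_le_factorial {S : Set (Fin 2 →₀ ℕ)} {L : ℕ} (r : Fin 2 →₀ ℕ) {P : Fin 2 →₀ ℕ} (hP : P ∈ S)
    (hP0 : P 0 < deltaL S) (hPδ : P 0 + P 1 = deltaL S) (hδL : deltaL S < L) :
    coeffOrd (deltaL S * (L - deltaL S)) (Finsupp.equivMapDomain (Equiv.swap (0 : Fin 2) 1) '' compSet L r S) ≤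
      (((deltaL S * (L - deltaL S)).factorial : ℕ) : ℕ∞) := by
  set δ := deltaL S with hδ
  have hmem : (L - δ) • P ∈ compSet L r S := by
    unfold compSet
    exact Set.mem_insert_of_mem _ ⟨P, hP, rfl⟩
  have hlt : ((L - δ) • P) 0 < δ * (L - δ) := by
    rw [Finsupp.smul_apply, smul_eq_mul]
    obtain ⟨t, ht⟩ : ∃ t, L - δ = t := ⟨_, rfl⟩
    have ht0 : 0 < t := by omega
    rw [ht]
    nlinarith
  have h := coeffOrd_le (S := Finsupp.equivMapDomain (Equiv.swap (0 : Fin 2) 1) '' compSet L r S) (δ := δ * (L - δ))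
    (P := Finsupp.equivMapDomain (Equiv.swap (0 : Fin 2) 1) ((L - δ) • P)) ⟨_, hmem, rfl⟩ (by rw [swapPt_apply_one]; exact hlt)
  rw [swapPt_apply_one, swapPt_apply_zero, Finsupp.smul_apply, Finsupp.smul_apply, smul_eq_mul, smul_eq_mul] at h
  have hP1 : P 1 = δ - P 0 := by omega
  have hden : δ * (L - δ) - (L - δ) * P 0 = (L - δ) * (δ - P 0) := by
    conv_rhs => rw [Nat.mul_sub, mul_comm (L - δ) δ]
  have hpos : 0 < (L - δ) * (δ - P 0) := Nat.mul_pos (by omega) (by omega)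
  have hdvd : (L - δ) * (δ - P 0) ∣ (δ * (L - δ)).factorial :=
    Nat.dvd_factorial hpos (by rw [mul_comm δ]; exact Nat.mul_le_mul_left _ (Nat.sub_le _ _))
  rw [hden, hP1, Nat.div_mul_cancel hdvd] at h
  exact h

/-- THE SWAPPED READING OF `sValue` IS `≤` THE FIRST READING, given a face point `P₀ < δ` of the reduced set (positions: every total degree
of `N` is `≥ L`). -/
theorem sValue_swap_le_of_face_point (E : Finset (Fin 2)) {L : ℕ} (hN : N.Nonempty) (hL : ∀ P ∈ N, L ≤ P 0 + P 1)
    {P : Fin 2 →₀ ℕ} (hP : P ∈ reduce (excExp E N) N) (hP0 : P 0 < dRes E N) (hPδ : P 0 + P 1 = dRes E N) :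
    sValue L (swapE E) (Finsupp.equivMapDomain (Equiv.swap (0 : Fin 2) 1) '' N) ≤ sValue L E N := by
  have hδ : dRes (swapE E) (Finsupp.equivMapDomain (Equiv.swap (0 : Fin 2) 1) '' N) = dRes E N := dRes_swap N E
  have hred : reduce (excExp (swapE E) (Finsupp.equivMapDomain (Equiv.swap (0 : Fin 2) 1) '' N))
      (Finsupp.equivMapDomain (Equiv.swap (0 : Fin 2) 1) '' N) =
      Finsupp.equivMapDomain (Equiv.swap (0 : Fin 2) 1) '' reduce (excExp E N) N := by
    rw [excExp_swap, reduce_swap]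
  by_cases hle : L ≤ dRes E N
  · -- plain case: `sFlag` on both sides
    rw [sValue_of_le (hδ ▸ hle), sValue_of_le hle]
    unfold sFlag
    rw [hδ, hred]
    exact le_trans (coeffOrd_swap_le_factorial hP hP0 hPδ) (factorial_le_coeffOrd fun Q hQ => dRes_le_of_mem_reduce hQ)
  rw [not_le] at hle
  by_cases h0 : 0 < dRes E N
  · -- companion case: `sComp` on both sides
    rw [sValue_of_lt (hδ ▸ hle) (hδ ▸ h0), sValue_of_lt hle h0]
    unfold sComp
    rw [hδ, hred, excExp_swap, compSet_swap]
    have hδS : deltaL (reduce (excExp E N) N) = dRes E N := rfl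
    refine le_trans ?_ (factorial_le_coeffOrd fun Q hQ => mul_sub_le_of_mem_compSet E hN hL hQ)
    have h := coeffOrd_swap_compSet_le_factorial (L := L) (excExp E N) hP (hδS ▸ hP0) (hδS ▸ hPδ) (hδS ▸ hle)
    rw [hδS] at h
    exact h
  · -- `δ = 0`: both readings are `⊤`
    have h00 : dRes E N = 0 := by omega
    have hL0 : 0 < L := by omega
    rw [sValue_of_eq_zero hL0 h00]
    exact le_top

end PointSets

/-! ### The Newton set and the flags of the letter-swapped tuple -/

/-- THE SCALED NEWTON SET OF THE SWAPPED TUPLE is the transpose of the scaled Newton set. -/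
theorem newtonSet_swapT (A : Fin d → MvPowerSeries (Fin 2) k) :
    newtonSet (swapT A) = Finsupp.equivMapDomain (Equiv.swap (0 : Fin 2) 1) '' newtonSet A := by
  ext P
  simp only [mem_newtonSet_iff, Set.mem_image]
  constructor
  · rintro ⟨j, e, he, rfl⟩
    rw [swapT_apply, PurePowerFlag.coeff_swap] at he
    exact ⟨slotWeight d j • Finsupp.equivMapDomain (Equiv.swap (0 : Fin 2) 1) e, ⟨j, _, he, rfl⟩,
      by rw [← smul_swapPt, swapPt_swapPt]⟩
  · rintro ⟨Q, ⟨j, e, he, rfl⟩, rfl⟩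
    refine ⟨j, Finsupp.equivMapDomain (Equiv.swap (0 : Fin 2) 1) e, ?_, (smul_swapPt _ _).symm⟩
    rw [swapT_apply, PurePowerFlag.coeff_swap, swapPt_swapPt]
    exact he

/-- A flag with the trivial shear: `flagTuple d A g 0 = shift d A g`. -/
theorem flagTuple_zero_shear (A : Fin d → MvPowerSeries (Fin 2) k) (g : MvPowerSeries (Fin 2) k) : flagTuple d A g 0 = shift d A g := by
  rw [flagTuple_def]
  congr 1
  funext j
  exact HauserPerlega2024.subst_shift_zero (0 : Fin 2) 1 (A j)

/-- The letter swap of a re-centred tuple is the re-centred letter swap (by the swapped germ). -/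
theorem swapT_shift (A : Fin d → MvPowerSeries (Fin 2) k) (g : MvPowerSeries (Fin 2) k) :
    swapT (shift d A g) = shift d (swapT A) (swap g) := by
  funext j
  rw [swapT_apply, swap, rename_eq_subst, subst_shift (HasSubst.X_comp _) A g j]
  have h1 : (fun i => subst (X ∘ ⇑(Equiv.swap (0 : Fin 2) 1)) (A i)) = swapT A := by
    funext i; rw [swapT_apply, swap, rename_eq_subst]
  have h2 : subst (X ∘ ⇑(Equiv.swap (0 : Fin 2) 1)) g = swap g := by rw [swap, rename_eq_subst]
  rw [h1, h2]

/-- THE SECOND-ORIENTATION FLAG `(g, 0)` IS THE FIRST-ORIENTATION FLAG `(swap g, 0)` READ ON THE SWAP: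
`flagTuple d (swapT A) g 0 = swapT (flagTuple d A (swap g) 0)`. -/
theorem flagTuple_swapT_zero (A : Fin d → MvPowerSeries (Fin 2) k) (g : MvPowerSeries (Fin 2) k) :
    flagTuple d (swapT A) g 0 = swapT (flagTuple d A (swap g) 0) := by
  rw [flagTuple_zero_shear, flagTuple_zero_shear, swapT_shift, PurePowerFlag.swap_swap]

/-- … hence its Newton set is the transpose. -/
theorem newtonSet_flagTuple_swapT_zero (A : Fin d → MvPowerSeries (Fin 2) k) (g : MvPowerSeries (Fin 2) k) :
    newtonSet (flagTuple d (swapT A) g 0) = Finsupp.equivMapDomain (Equiv.swap (0 : Fin 2) 1) '' newtonSet (flagTuple d A (swap g) 0) := by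
  rw [flagTuple_swapT_zero, newtonSet_swapT]

/-- … the same `m` (boundary swapped), -/
theorem mOf_swapT_zero (A : Fin d → MvPowerSeries (Fin 2) k) (E : Finset (Fin 2)) (g : MvPowerSeries (Fin 2) k) :
    mOf d (swapT A) (swapE E) g 0 = mOf d A E (swap g) 0 := by
  rw [mOf_of_isN0 (Or.inr rfl : IsN0 (swapE E) (0 : PowerSeries k)), mOf_of_isN0 (Or.inr rfl : IsN0 E (0 : PowerSeries k)),
    newtonSet_flagTuple_swapT_zero, excExp_swap, swapPt_apply_zero, swapPt_apply_one, add_comm]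

/-- … and the same validity. -/
theorem isMMax_swapT_zero_iff (A : Fin d → MvPowerSeries (Fin 2) k) (E : Finset (Fin 2)) (g : MvPowerSeries (Fin 2) k) :
    IsMMax d (swapT A) (swapE E) g 0 ↔ IsMMax d A E (swap g) 0 := by
  unfold IsMMax
  constructor
  · intro h g' hg'
    have h' := h (swap g') (by rw [swap, constantCoeff_rename]; exact hg')
    rwa [mOf_swapT_zero, mOf_swapT_zero, PurePowerFlag.swap_swap] at h'
  · intro h g' hg'
    have h' := h (swap g') (by rw [swap, constantCoeff_rename]; exact hg')
    rwa [mOf_swapT_zero, mOf_swapT_zero]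

/-- LEMMA 9.1.2 IN GAME FORM, comparison half: given a FACE POINT `P₀ < δ` of the reduced set of the first-orientation reading `(swap g, 0)`
of a position, the second-orientation flag `(true, g, 0)` is `≤` the first-orientation flag `(swap g, 0)` of the same position — same `d`,
`n = 0`, and `s` never larger. -/
theorem flagTriple_swapT_zero_le (A : Fin d → MvPowerSeries (Fin 2) k) (E : Finset (Fin 2)) (g : MvPowerSeries (Fin 2) k)
    (hne : (newtonSet (flagTuple d A (swap g) 0)).Nonempty)
    (hL : ∀ P ∈ newtonSet (flagTuple d A (swap g) 0), d.factorial ≤ P 0 + P 1) {P : Fin 2 →₀ ℕ}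
    (hP : P ∈ reduce (excExp E (newtonSet (flagTuple d A (swap g) 0))) (newtonSet (flagTuple d A (swap g) 0)))
    (hP0 : P 0 < dRes E (newtonSet (flagTuple d A (swap g) 0)))
    (hPδ : P 0 + P 1 = dRes E (newtonSet (flagTuple d A (swap g) 0))) :
    flagTriple d (swapT A) (swapE E) g 0 ≤ flagTriple d A E (swap g) 0 := by
  rw [flagTriple_of_isN0 (Or.inr rfl : IsN0 (swapE E) (0 : PowerSeries k)), flagTriple_of_isN0 (Or.inr rfl : IsN0 E (0 : PowerSeries k)),
    newtonSet_flagTuple_swapT_zero, dRes_swap]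
  have hs := sValue_swap_le_of_face_point (newtonSet (flagTuple d A (swap g) 0)) E hne hL hP hP0 hPδ
  exact Prod.Lex.toLex_mono ⟨le_rfl, Prod.Lex.toLex_mono ⟨le_rfl, hs⟩⟩

end WildMonic

end Summit.ResolutionOfSingularities.ResolutionOfSingularities.Theorems

end
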